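import Literature.MathematicalPhysics.QuantumFieldTheory.Balaban1983to89.B9Eq3105FamThreeLocDiffGAssembly
import Literature.MathematicalPhysics.QuantumFieldTheory.Balaban1983to89.B9CubeLettersInvReadDict
import Literature.MathematicalPhysics.QuantumFieldTheory.Balaban1983to89.B9Eq3105FamThreeAtLocCfg

/-!
# `Balaban1983to89.B9Eq3105FamThreeLocDiffGOfEBlock` — FAMILY 3 OF (3.105): THE LOCATED `G′`-DIFFERENCE ENTRY `hDL □ μ` AT `χl_□`, READ OFF THE CONSUMER's DATA —
# F3-E2c's displayed inputs `hDG`∕`hG` are the (3.42) entries 1∕0 of `η²G′(U₁)` from the inverse-family `EBlock` (`B9CubeLettersInvReadDict`), and `hT` is F3-E2b's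
# member majorant of the commutator letter from p21 D3's cube-side `hR` at `Ṽ_□`; what stays displayed is exactly the consumer's standing data: `hE`, `hR`,
# `IsUnit Δ′_a(U₁)`, `IsUnit Δ′_{a,□}(Ṽ^{u⁻¹})`, the (3.35) datum, the cube and member (2.61), budgets; §3 threads it into F3-P's record theorem (the family-3 sum at
# the located letters with `hDL` DISCHARGED, `hDR`∕`hP3` displayed) (sub-row G-B9-LETTERS, GAPS G-B9-p33-01 (D1-left), programme FAMTHREE FILE F3-E2d; design
# `lit-balaban-p33/g103/F3E-SCOPE.md`)

statement-level skeleton of published theorems with citation tags; proofs where landed; nothing here is a claim about the Yang–Mills mass gap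

THE PRINTED LOCUS (verbatim, held `paper:balaban1985-cmp99-background-propagators`, journal page = PDF page + 388).  p. 415 l.29–31 «Next we replace the operators
G′_{□₀} and C_{□₀} by G′_□, C_□, terms with the differences G′_{□₀} − G′_□ and C_{□₀} − C_□ are small by the same reason as before.»; p. 412 l.22–36; (3.42)
p. 397, (3.49) p. 399, (3.88)–(3.89) p. 409, Cor. 3.6 p. 408; [4] (2.51)–(2.55) p. 232, Lemma 2.1 (2.61) p. 234; [2] (1.11)–(1.12) (statement type).

WHAT THIS FILE CERTIFIES (kernel-checked; 0 `def`, 0 `def … : Prop`, 0 sorry; standard axioms only)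

* §1–§2 `restrict_smul_apply` (bookkeeping: `((η²:ℂ)·O)^ℝ Λ = η²·O Λ`), `hasMajorant_commStep_member_rate` (F3-E2b's kernel under the rate trade `b·δ_G ≤ (1−α)δ`),
  ★★★ `hasMajorant_hDL_chiL_of_eBlock` — F3-P's `hDL □ μ` at `χ □ := χl_□`, `Gp := GpY i (parSymY i)`, `parS := parSymY i`, from: `hE : EBlock (kernelFamilySInv i B cfg
  (GpY i (parSymY i)) (parSymY i)) B_G δ_G U₁`, p21 D3's cube-side `hR` at `Ṽ_□ = locCfgY i □ η₁ A` (kernel `θ_R·e^{−δd_□}`), a bi-contractive `u_□`, `IsUnit Δ′_a(cfg U₁)`,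
  `IsUnit Δ′_{a,□}(Ṽ_□^{u⁻¹})`, the datum, the cube (2.61) at `(δ, α)` and the member (2.61) at `(δ_G, b − ρ)` with `b·δ_G ≤ (1−α)δ`, `a_sep + ρ ≤ 1`, `η = |c_f|⁻¹`.
  Kernel `ε_D·ℓ(a)·e^{−ρδ_Gd}` UNIFORM IN □, `ε_D = M₂ΣB_G·(1 + D₁θ∕3)·(e^{−a_sepδ_G(3M_h∕8 − 1)} + (M₂Σ)²θ_Rc₁(dB_c, δ, α)·c₁(dB, δ_G, b − ρ)·e^{−a_sepδ_G(3M_h∕8 − 2)})`.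
* §3 ★★★ `hasMajorant_sum_famThree_at_locCfg_chiL` — THE RECORD WITH `hDL` DISCHARGED: F3-P's `hasMajorant_sum_famThree_at_locLetters` at `parS := parSymY i`,
  `Gp := GpY i (parSymY i)`, `Ṽ_□ := locCfgY i □ η (A □)`, `χ □ := χl_□` (plateau hypotheses = p38's `chiL_eq_one_of_{zetaY,hTY}_gradK`, site agreement = the datum),
  `hDL` = §2 folded with `hDR` (displayed, ANY constants `(ε_R, δ_R)` — p38 F3-E3's shape) to a common kernel `ε_T·ℓ(a)·e^{−δ_Td}` (`ε_D, ε_R ≤ ε_T`, `δ_T ≤ ρδ_G, δ_R`) —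
  the `hrest` family-3 summand `∑_□ conj b((M_{ζ_□♭}·(DP_aD*(U₁) − P^loc_□)·M_{h_□♭}O_□M_{h_□♭})^ℝ)` over `(toB6 (geo9K i) Rr′ Hp, ιB∘blkV1)`, now modulo: `hDR` (D1-right),
  `hP3` (D2), the cube-side `hR □`, `hU`∕`hV □`, bi-contractive `u □`, the (2.61)'s, scale transfers, budgets, the letters' blocks (`hE`, `hEO`, `hCinv`).

HONEST SCOPE ∕ NOT CLAIMED.  D1-left of GAPS G-B9-p33-01 is hereby SUPPLIED at `χl_□` and threaded to the record, modulo the consumer's standing data only (listed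
above; `hR` is p21 D3 `B9ThmDCommutatorStep.hasMajorant_conj_commStep`'s conclusion at the datum, displayed as in D4∕D5∕F3-PT).  STILL DISPLAYED at the record:
`hDR` (D1-right — p38 g47 F3-E3 in flight) and `hP3` (D2 — F3-B3, `g103/F3B3-SCOPE.md`).  Count-neutral; NOT a node discharge; no summit ∕ sub-problem statement is
proved; nothing continuum ∕ OS ∕ mass-gap ∕ Clay; YM mass gap NOT proved (Track A conditional rung).  No `sorry`, no `axiom`, no `… : Prop` fact, no `instance`,
no `notation`, no `def`.  NEW file; nothing landed is modified.  Cell `lit-balaban`, seat `lit-balaban-p33` gen 103, 2026-08-29; `--supports stmt-QuantumFields-19200`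
as helper.  Net new unproved facts: 0.

RELATED IN THE TREE, NOT DUPLICATED (searched 2026-08-29: `rg 'at_locCfg_chiL|hDL_chiL_of_eBlock' Literature/` = ∅): F3-P `B9Eq3105FamThreeAtLocCfg` (the `chiY` record,
`hDL` displayed), F3-E2c `B9Eq3105FamThreeLocDiffGAssembly`, F3-E2b, `B9CubeLettersInvReadDict`, p38 `B9Cor36CollarSeparation` — all USED BY NAME.
-/

noncomputable section

namespace Literature.MathematicalPhysics.QuantumFieldTheory.Balaban1983to89.B9Eq3105FamThreeLocDiffGOfEBlock

open NormedSpace Complex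
open B6RandomWalk (HasMajorant hasMajorant_mono Ineq261 c1_nonneg)
open B9Thm34Ext (toB6)
open B9FromB6 (EBlock)
open B9Eq352DivFormLetters (conj)
open B9Eq352GradLetters (diffLetter)
open B9Eq39Adjoint (fluct)
open B9Eq360DeltaPrimeAY (AfldY)
open B9Eq360DeltaPrimeACubeY (blkCubeY)
open B6KLevelCensusIndexV1 (KIdx kGeo)
open B6Cover236MultiLevelBlocks (cubes)
open B6GlobalChartV1 (PV boxEquiv)
open B6Geom246MultiLevelBox (blkOf)
open B6Ineq2142KLevelV1 (β)
open B9GeoNormsKLevelV1 (geo9K)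
open B9CubeGeometryInputs (geoCK)
open B9CubeLettersOpsL0 (deltaPrimeACubeY GpCubeY)
open B9CubeLettersInvReadings (kernelFamilySInv)
open B9CubeLettersInvReadDict (hasMajorant_conj_G_of_eBlockInv hasMajorant_gradF_mul_G_of_eBlockInv)
open B9Thm37CubeCoverCommutators (cutMulY)
open B4PartitionUnity22 (thetaProf D1)
open B9Cor36CutoffField337 (bumpY)
open B9Cor36CubeCutoffs (SC NearC chiY ctrR locCfgY)
open B9Eq3105FamTwoCore (geo9K_axioms)
open B9Eq3105FamThreeCommStepMember (hasMajorant_conj_commStep_member)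
open B9Eq3105FamThreeLocDiffGAssembly (hasMajorant_hDL_chiL)
open B9Eq3105FamThreeAtLocCfg (agree_of_datum hasMajorant_sum_famThree_at_locLetters)
open B9Cor36CollarSeparation (chiL_eq_one_of_zetaY_gradK chiL_eq_one_of_hTY_gradK)
open B9Ineq347 (ScaleTransfer)
open B6GlobalChartV1 (blkV1)
open B9Eq3104CutoffCommutators (hBdY DPDsY)
open B9Eq3105ZetaY (zetaY)
open B9Thm37CubeCoverCommutators (hTY)
open B9CubeLettersBondOpsL0 (QpCubeY QpsCubeY XinvCubeY)
open B9CubeLettersInvReadings (kernelFamilyBInv)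
open B9Cor36GCubeLocLetter (locProjBY)
open Node00 (SiteY BlkY IBondY FBondY CfgY GaugeY BondOpY BondParY toKT shiftY UboxY GpY deltaPrimeAY gaugeY parSymY etaS parSymY_isGaugeLawS QpY QpsY XinvY gradY divY)

variable {d ℓ : ℕ} {hd : 1 ≤ d + 1} {hL : Odd (ℓ + 1) ∧ 1 < ℓ + 1} {b₀ b₁ : ℝ}
variable {𝔸 : Type} [NormedRing 𝔸] [NormedAlgebra ℂ 𝔸] [CompleteSpace 𝔸]
variable {ι : Type} [Fintype ι]
variable (i : KIdx d ℓ hd hL b₀ b₁) (c : ↥(cubes (toKT i).D.toDomains)) (b : Module.Basis ι ℝ 𝔸)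

omit [CompleteSpace 𝔸] in
/-- bookkeeping: `((η²:ℂ)·O)^ℝ Λ = η²·(O Λ)` (real scalar). [cite: Balaban1984PropagatorsII, (2.51) p.232, bookkeeping] -/
theorem restrict_smul_apply (η : ℝ) (O : Module.End ℂ (SiteY i → 𝔸)) (Λ : SiteY i → 𝔸) :
    ((((η ^ 2 : ℝ) : ℂ) • O).restrictScalars ℝ) Λ = (η ^ 2) • O Λ := by
  rw [LinearMap.restrictScalars_apply, LinearMap.smul_apply, ← algebraMap_smul ℂ (η ^ 2) (O Λ)]
  rfl

section Main

variable [Fintype (geo9K i).Site] [DecidableEq (geo9K i).Site] {Rr : ℝ} {H : Prop} {Rr' : ℝ} {Hp : Prop}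

omit [DecidableEq (geo9K i).Site] in
/-- F3-E2b's member majorant under the rate trade `b·δ_G ≤ (1−α)δ`: kernel `((M₂Σ)²θ_Rc₁)·e^{−bδ_Gd}`. [cite: Balaban1984PropagatorsII, (2.46) p.231, bookkeeping] -/
theorem hasMajorant_commStep_member_rate {M₂ : ℝ} (hM₂ : 0 ≤ M₂) (hrepr : ∀ (v : 𝔸) (j : ι), |b.repr v j| ≤ M₂ * ‖v‖)
    (g : GaugeY 𝔸 i) (hg : ∀ x, ‖((g x : 𝔸ˣ) : 𝔸)‖ ≤ 1 ∧ ‖(((g x)⁻¹ : 𝔸ˣ) : 𝔸)‖ ≤ 1) (V : CfgY 𝔸 i)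
    (ιB : BlkY i → IBondY i) (hι : ∀ s, β i.hN i.D i.hk (ιB s) = s) (dB : ℕ) {θ δ α bb δG : ℝ} (hθ : 0 ≤ θ) (hδ : 0 ≤ δ) (hα1 : α ≤ 1)
    (hrate : bb * δG ≤ (1 - α) * δ) (h261 : Ineq261 dB (toB6 (geoCK i c) Rr H) δ α)
    (hR : HasMajorant (g := toB6 (geoCK i c) Rr H) (fun p : SiteY i × ι => blkCubeY i c p.1)
      (conj b (((cutMulY (𝔸 := 𝔸) (chiY i c) * deltaPrimeACubeY i c (parSymY i) V - deltaPrimeACubeY i c (parSymY i) V * cutMulY (𝔸 := 𝔸) (chiY i c)) *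
        GpCubeY i c (parSymY i) V).restrictScalars ℝ))
      (fun a s => θ * Real.exp (-(δ * (geoCK i c).dist a s)))) :
    HasMajorant (g := toB6 (geo9K i) Rr' Hp) (fun p : SiteY i × ι => ιB (blkOf i.D.toDomains p.1))
      (conj b (((cutMulY (𝔸 := 𝔸) (chiY i c) * deltaPrimeACubeY i c (parSymY i) (gaugeY i g⁻¹ V) -
          deltaPrimeACubeY i c (parSymY i) (gaugeY i g⁻¹ V) * cutMulY (𝔸 := 𝔸) (chiY i c)) * GpCubeY i c (parSymY i) (gaugeY i g⁻¹ V)).restrictScalars ℝ))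
      (fun y a' => ((M₂ * ∑ j, ‖b j‖) ^ 2 * (θ * B6.c1 dB δ α)) * Real.exp (-(bb * δG * (geo9K i).dist y a'))) := by
  obtain ⟨-, -, hdnn⟩ := geo9K_axioms i Rr' Hp
  refine hasMajorant_mono (g := toB6 (geo9K i) Rr' Hp) _
    (hasMajorant_conj_commStep_member i c b hM₂ hrepr (parSymY_isGaugeLawS i) g hg V ιB hι dB hθ hδ hα1 h261 hR) fun y a' => ?_
  rw [← mul_assoc]
  refine mul_le_mul_of_nonneg_left (Real.exp_le_exp.2 (neg_le_neg ?_)) (mul_nonneg (sq_nonneg _) (mul_nonneg hθ (c1_nonneg _ _ _)))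
  exact mul_le_mul_of_nonneg_right hrate (hdnn y a')

/-- ★★★ **F3-P's `hDL □ μ` AT `χl_□`, READ OFF THE CONSUMER's DATA** (`Gp := GpY i (parSymY i)`, `parS := parSymY i`): from the inverse-family `EBlock` of `G′` (entries
0∕1 of `η²G′(U₁)`), p21 D3's cube-side `hR` at `Ṽ_□`, a bi-contractive `u_□`, `IsUnit Δ′_a(cfg U₁)`, `IsUnit Δ′_{a,□}(Ṽ_□^{u⁻¹})`, the (3.35) datum, the cube (2.61) at
`(δ, α)` and the member (2.61) at `(δ_G, b − ρ)` with `b·δ_G ≤ (1−α)δ`, `a_sep + ρ ≤ 1`.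
[cite: Balaban1985BackgroundPropagators, p.415 l.29–31, p.412 l.22–36, (3.42) p.397, (3.49) p.399, (3.88)–(3.89) p.409, Cor. 3.6 p.408; Balaban1983RegularityDecay, (1.11)–(1.12) (statement type); Balaban1984PropagatorsII, (2.51)–(2.55) p.232, (2.46) p.231, Lemma 2.1 (2.61) p.234] -/
theorem hasMajorant_hDL_chiL_of_eBlock {B : B9.Backgrounds} (cfg : B.Cfg → CfgY 𝔸 i) {U₁ : B.Cfg} {BG δG : ℝ}
    (hE : EBlock (kernelFamilySInv i B cfg (fun W => GpY i (parSymY i) W) (parSymY i)) BG δG U₁) (hBG : 0 ≤ BG) (hδG : 0 ≤ δG)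
    (ιB : BlkY i → IBondY i) (hι : ∀ s, β i.hN i.D i.hk (ιB s) = s) {M₂ : ℝ} (hM₂ : 0 ≤ M₂) (hrepr : ∀ (v : 𝔸) (j : ι), |b.repr v j| ≤ M₂ * ‖v‖)
    (hη : etaS i = |i.cf|⁻¹) (g : GaugeY 𝔸 i) (hg : ∀ x, ‖((g x : 𝔸ˣ) : 𝔸)‖ ≤ 1 ∧ ‖(((g x)⁻¹ : 𝔸ˣ) : 𝔸)‖ ≤ 1)
    {Q : Set (Site (PV d ℓ i.m i.K hd hL) 0)} (η₁ : ℝ) (A : AfldY 𝔸 i)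
    (hQ : ∀ x : Site (PV d ℓ i.m i.K hd hL) 0, NearC i c (35 * SC i c / 8 + 1) (boxEquiv i.hN x).1 → x ∈ Q)
    (hgA : ∀ (κ : Fin (d + 1)) (x : Site (PV d ℓ i.m i.K hd hL) 0), x ∈ Q → x.shift κ ∈ Q → gaugeY i g (cfg U₁) κ x = fluct η₁ A κ x)
    (hU : IsUnit (deltaPrimeAY i (parSymY i) (cfg U₁))) (hV : IsUnit (deltaPrimeACubeY i c (parSymY i) (gaugeY i g⁻¹ (locCfgY i c η₁ A))))
    (μ : Fin (d + 1)) (dBc dB : ℕ) {θ δ α asep ρ bb : ℝ} (hθ : 0 ≤ θ) (hδ : 0 ≤ δ) (hα1 : α ≤ 1) (hasep : 0 ≤ asep) (hρ : 0 ≤ ρ) (hsplit : asep + ρ ≤ 1)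
    (hrate : bb * δG ≤ (1 - α) * δ) (h261c : Ineq261 dBc (toB6 (geoCK i c) Rr H) δ α) (h261 : Ineq261 dB (toB6 (geo9K i) Rr' Hp) δG (bb - ρ))
    (hR : HasMajorant (g := toB6 (geoCK i c) Rr H) (fun p : SiteY i × ι => blkCubeY i c p.1)
      (conj b (((cutMulY (𝔸 := 𝔸) (chiY i c) * deltaPrimeACubeY i c (parSymY i) (locCfgY i c η₁ A) -
          deltaPrimeACubeY i c (parSymY i) (locCfgY i c η₁ A) * cutMulY (𝔸 := 𝔸) (chiY i c)) * GpCubeY i c (parSymY i) (locCfgY i c η₁ A)).restrictScalars ℝ))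
      (fun a s => θ * Real.exp (-(δ * (geoCK i c).dist a s)))) :
    HasMajorant (g := toB6 (geo9K i) Rr' Hp) (fun p : SiteY i × ι => ιB (blkOf i.D.toDomains p.1))
      (conj b (diffLetter (shiftY i) (UboxY i (cfg U₁)) (((etaS i : ℝ) : ℂ))⁻¹ (Sum.inl μ)) *
        conj b (((etaS i ^ 2) • (cutMulY (𝔸 := 𝔸) (bumpY i (ctrR i c) (3 * (SC i c : ℝ))) ∘ₗ
          (GpY i (parSymY i) (cfg U₁) - GpCubeY i c (parSymY i) (gaugeY i g⁻¹ (locCfgY i c η₁ A))))).restrictScalars ℝ))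
      (fun a a' => ((M₂ * (∑ j, ‖b j‖) * BG * (1 + D1 thetaProf / 3)) *
          (Real.exp (-(asep * δG * (3 / 8 * (i.Mh : ℝ) - 1))) +
            ((M₂ * ∑ j, ‖b j‖) ^ 2 * (θ * B6.c1 dBc δ α)) * B6.c1 dB δG (bb - ρ) * Real.exp (-(asep * δG * (3 / 8 * (i.Mh : ℝ) - 2))))) *
        (geo9K i).len a * Real.exp (-(ρ * δG * (geo9K i).dist a a'))) := by
  have hSum : 0 ≤ M₂ * ∑ j, ‖b j‖ := mul_nonneg hM₂ (Finset.sum_nonneg fun j _ => norm_nonneg _)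
  -- `|η⁻¹|·η_k = 1` (`η = η_k = |c_f|⁻¹`) and `(D₁θ∕(3S_j))·S_j = D₁θ∕3`: the constant is uniform in □
  have hηk : |(etaS i)⁻¹| * (kGeo i).eta = 1 := by
    have hpos : 0 < etaS i := B9Ineq349SiteComposite.etaS_pos i
    have hcf : |i.cf| ≠ 0 := fun h0 => by rw [hη, h0, inv_zero] at hpos; exact lt_irrefl _ hpos
    rw [show (kGeo i).eta = |i.cf|⁻¹ from rfl, hη, inv_inv, abs_abs, mul_inv_cancel₀ hcf]
  have hS0 : (SC i c : ℝ) ≠ 0 := by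
    have h3 := B9Eq3105FamThreeLocDiffGAssembly.three_SC_pos i c
    intro h0; rw [h0, mul_zero] at h3; exact lt_irrefl _ h3
  have hconst : M₂ * (∑ j, ‖b j‖) * BG + (|(etaS i)⁻¹| * (D1 thetaProf / (3 * (SC i c : ℝ)))) * ((SC i c : ℝ) * (kGeo i).eta) * (M₂ * (∑ j, ‖b j‖) * BG) =
      M₂ * (∑ j, ‖b j‖) * BG * (1 + D1 thetaProf / 3) := by
    have e : (|(etaS i)⁻¹| * (D1 thetaProf / (3 * (SC i c : ℝ)))) * ((SC i c : ℝ) * (kGeo i).eta) =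
        (|(etaS i)⁻¹| * (kGeo i).eta) * (D1 thetaProf / 3) := by
      have e1 : D1 thetaProf / (3 * (SC i c : ℝ)) * (SC i c : ℝ) = D1 thetaProf / 3 := by
        rw [div_mul_eq_mul_div, mul_div_mul_right _ _ hS0]
      calc |(etaS i)⁻¹| * (D1 thetaProf / (3 * (SC i c : ℝ))) * ((SC i c : ℝ) * (kGeo i).eta)
          = |(etaS i)⁻¹| * (kGeo i).eta * (D1 thetaProf / (3 * (SC i c : ℝ)) * (SC i c : ℝ)) := by ring
        _ = _ := by rw [e1]
    rw [e, hηk, one_mul]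
    ring
  rw [← hconst]
  set G : Module.End ℝ (SiteY i → 𝔸) := ((((etaS i ^ 2 : ℝ) : ℂ)) • GpY i (parSymY i) (cfg U₁)).restrictScalars ℝ with hGdef
  have hG : ∀ Λ, G Λ = (etaS i ^ 2) • (fun W => GpY i (parSymY i) W) (cfg U₁) Λ := fun Λ => restrict_smul_apply i (etaS i) _ Λ
  have hDG := hasMajorant_gradF_mul_G_of_eBlockInv i b cfg (fun W => GpY i (parSymY i) W) (parSymY i) (Rr := Rr') (Hp := Hp) hE hBG ιB hι hM₂ hrepr
    (η := etaS i) rfl (Uc := UboxY i (cfg U₁)) rfl G hG μ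
  have hG0 := hasMajorant_conj_G_of_eBlockInv i b cfg (fun W => GpY i (parSymY i) W) (parSymY i) (Rr := Rr') (Hp := Hp) hE hBG ιB hι hM₂ hrepr
    (η := etaS i) rfl G hG
  have hT := hasMajorant_commStep_member_rate i c b (Rr := Rr) (H := H) (Rr' := Rr') (Hp := Hp) hM₂ hrepr g hg (locCfgY i c η₁ A) ιB hι dBc hθ hδ hα1
    hrate h261c hR
  exact hasMajorant_hDL_chiL i c b ιB hι (cfg U₁) g η₁ A hQ hgA hU hV (etaS i) μ dB (mul_nonneg hSum hBG) (mul_nonneg hSum hBG)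
    (mul_nonneg (sq_nonneg _) (mul_nonneg hθ (c1_nonneg _ _ _))) hδG hasep hρ hsplit h261 hDG hG0 hT

end Main

/-! ## §3  The record: F3-P's family-3 sum with `hDL` DISCHARGED at `χl_□` -/

section Record

variable [Fintype (geo9K i).Site] [DecidableEq (geo9K i).Site] {Rr : ℝ} {H : Prop} {Rr' : ℝ} {Hp : Prop}
variable {B : B9.Backgrounds} (cfg : B.Cfg → CfgY 𝔸 i) (par : BondParY 𝔸 i) {U₁ : B.Cfg}

set_option maxHeartbeats 6400000 in
/-- ★★★ **F3-P AT THE RECORD WITH `hDL` DISCHARGED**: `B9Eq3105FamThreeAtLocCfg.hasMajorant_sum_famThree_at_locLetters` at `parS := parSymY i`, `Gp := GpY i (parSymY i)`,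
`Ṽ_□ := locCfgY i □ η (A □)`, the located cut-off `χ □ := χl_□ = bumpY i (ctrR i □) (3S_j)` (plateau hypotheses = p38's `chiL_eq_one_of_{zetaY,hTY}_gradK`), the site
agreement from the datum, and `hDL □ μ` SUPPLIED by `hasMajorant_hDL_chiL_of_eBlock`, folded with the displayed `hDR` (any constants `ε_R ≤ ε_T`, `δ_T ≤ δ_R`) to the
common kernel `ε_T·ℓ(a)·e^{−δ_Td}` — the `hrest` family-3 summand at the located projection letters, now modulo `hDR` (D1-right, p38 F3-E3), `hP3` (D2), p21 D3's
cube-side `hR □`, the inverse laws `hU`∕`hV □`, bi-contractive `u □`, the cube and member (2.61), budgets, and the letters' blocks.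
[cite: Balaban1985BackgroundPropagators, (3.105) p.414, p.415 l.29–37, p.412 l.22–36, Cor. 3.6 p.408, (3.42) p.397, (3.49) p.399, (3.87)–(3.89) p.409; Balaban1983RegularityDecay, (1.11)–(1.12) (statement type); Balaban1984PropagatorsII, (2.51)–(2.55) p.232, (2.46) p.231, Lemma 2.1 (2.61) p.234] -/
theorem hasMajorant_sum_famThree_at_locCfg_chiL
    {BG δG : ℝ} (hE : EBlock (kernelFamilySInv i B cfg (fun W => GpY i (parSymY i) W) (parSymY i)) BG δG U₁) (hBG : 0 ≤ BG) (hδG0 : 0 ≤ δG)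
    (Oc : ↥(cubes i.D.toDomains) → BondOpY 𝔸 i) {B₀ δ : ℝ} (hB₀ : 0 ≤ B₀) (hδ : 0 < δ)
    (hEO : ∀ c : ↥(cubes i.D.toDomains), EBlock (kernelFamilyBInv i B cfg (Oc c) par) B₀ δ U₁)
    (ιB : BlkY i → IBondY i) (hι : ∀ s, β i.hN i.D i.hk (ιB s) = s)
    (hpar : ∀ z w : SiteY i, ‖(parSymY i (cfg U₁) z w : 𝔸)‖ ≤ 1 ∧ ‖(((parSymY i (cfg U₁) z w)⁻¹ : 𝔸ˣ) : 𝔸)‖ ≤ 1)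
    {M₂ : ℝ} (hM₂ : 0 ≤ M₂) (hrepr : ∀ (v : 𝔸) (j : ι), |b.repr v j| ≤ M₂ * ‖v‖) (hη : etaS i = |i.cf|⁻¹)
    {s B₁ δX : ℝ} (hs : (etaS i ^ 2 * etaS i ^ 2) * s = 1) (hB₁ : 0 ≤ B₁)
    (hCinv : HasMajorant (g := toB6 (geo9K i) Rr' Hp) (fun q : BlkY i × ι => ιB q.1) (conj b (s • (XinvY i (parSymY i) (fun W => GpY i (parSymY i) W) (cfg U₁)).restrictScalars ℝ))
      (fun a a' => B₁ * ((geo9K i).len a ^ 4)⁻¹ * Real.exp (-(δX * (geo9K i).dist a a'))))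
    (u : ↥(cubes i.D.toDomains) → GaugeY 𝔸 i) (hu : ∀ (c : ↥(cubes i.D.toDomains)) (x), ‖((u c x : 𝔸ˣ) : 𝔸)‖ ≤ 1 ∧ ‖(((u c x)⁻¹ : 𝔸ˣ) : 𝔸)‖ ≤ 1)
    (A : ↥(cubes i.D.toDomains) → AfldY 𝔸 i)
    (Q : ↥(cubes i.D.toDomains) → Set (Site (PV d ℓ i.m i.K hd hL) 0)) (η : ℝ)
    (hQ : ∀ (c : ↥(cubes i.D.toDomains)) (x : Site (PV d ℓ i.m i.K hd hL) 0), NearC i c (35 * SC i c / 8 + 1) (boxEquiv i.hN x).1 → x ∈ Q c)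
    (hgA : ∀ (c : ↥(cubes i.D.toDomains)) (κ : Fin (d + 1)) (x : Site (PV d ℓ i.m i.K hd hL) 0), x ∈ Q c → x.shift κ ∈ Q c →
      gaugeY i (u c) (cfg U₁) κ x = fluct η (A c) κ x)
    (hU : IsUnit (deltaPrimeAY i (parSymY i) (cfg U₁)))
    (hV : ∀ c : ↥(cubes i.D.toDomains), IsUnit (deltaPrimeACubeY i c (parSymY i) (gaugeY i (u c)⁻¹ (locCfgY i c η (A c)))))
    (dBc dBE : ℕ) {θ δc αc asep ρE bb : ℝ} (hθ : 0 ≤ θ) (hδc : 0 ≤ δc) (hαc1 : αc ≤ 1) (hasep : 0 ≤ asep) (hρE : 0 ≤ ρE) (hsplitE : asep + ρE ≤ 1)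
    (hrate : bb * δG ≤ (1 - αc) * δc) (h261c : ∀ c : ↥(cubes i.D.toDomains), Ineq261 dBc (toB6 (geoCK i c) Rr H) δc αc)
    (h261E : Ineq261 dBE (toB6 (geo9K i) Rr' Hp) δG (bb - ρE))
    (hR : ∀ c : ↥(cubes i.D.toDomains), HasMajorant (g := toB6 (geoCK i c) Rr H) (fun p : SiteY i × ι => blkCubeY i c p.1)
      (conj b (((cutMulY (𝔸 := 𝔸) (chiY i c) * deltaPrimeACubeY i c (parSymY i) (locCfgY i c η (A c)) -
          deltaPrimeACubeY i c (parSymY i) (locCfgY i c η (A c)) * cutMulY (𝔸 := 𝔸) (chiY i c)) * GpCubeY i c (parSymY i) (locCfgY i c η (A c))).restrictScalars ℝ))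
      (fun a s' => θ * Real.exp (-(δc * (geoCK i c).dist a s'))))
    {εT δT εR δR : ℝ}
    (hεDT : (M₂ * (∑ j, ‖b j‖) * BG * (1 + D1 thetaProf / 3)) *
          (Real.exp (-(asep * δG * (3 / 8 * (i.Mh : ℝ) - 1))) +
            ((M₂ * ∑ j, ‖b j‖) ^ 2 * (θ * B6.c1 dBc δc αc)) * B6.c1 dBE δG (bb - ρE) * Real.exp (-(asep * δG * (3 / 8 * (i.Mh : ℝ) - 2)))) ≤ εT)
    (hδDT : δT ≤ ρE * δG) (hεR : εR ≤ εT) (hδR : δT ≤ δR)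
    (hDR : ∀ (c : ↥(cubes i.D.toDomains)) (ν : Fin (d + 1)), HasMajorant (g := toB6 (geo9K i) Rr' Hp) (fun p : SiteY i × ι => ιB (blkOf i.D.toDomains p.1))
      (conj b ((etaS i ^ 2) • ((GpY i (parSymY i) (cfg U₁) - GpCubeY i c (parSymY i) (gaugeY i (u c)⁻¹ (locCfgY i c η (A c)))) ∘ₗ
          cutMulY (𝔸 := 𝔸) (bumpY i (ctrR i c) (3 * (SC i c : ℝ)))).restrictScalars ℝ) *
        conj b (diffLetter (shiftY i) (UboxY i (cfg U₁)) (((etaS i : ℝ) : ℂ))⁻¹ (Sum.inr ν)))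
      (fun a a' => εR * (geo9K i).len a * Real.exp (-(δR * (geo9K i).dist a a'))))
    (dB : ℕ) {δ₀ δP α β' ρ Λ : ℝ} (hΛ : 1 ≤ Λ) (hρ : 0 ≤ ρ) (hα : 0 ≤ α) (hβ : 0 ≤ β') (hδ₀ : 0 ≤ δ₀)
    (hδG' : δP ≤ δG) (hδX' : δP ≤ δX) (hδD' : δP ≤ δT) (hr : ρ + (2 * α + β') * δ₀ ≤ δP)
    (h261 : Ineq261 dB (toB6 (geo9K i) Rr' Hp) δ₀ β')
    (hT1 : ScaleTransfer (geo9K i) δ₀ α Λ (fun a => (geo9K i).len a)) (hT4 : ScaleTransfer (geo9K i) δ₀ α Λ (fun a => ((geo9K i).len a ^ 4)⁻¹))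
    {ε₃ : ℝ} (hε₃ : 0 ≤ ε₃)
    (hP3 : ∀ c : ↥(cubes i.D.toDomains), HasMajorant (g := toB6 (geo9K i) Rr' Hp) (fun p : FBondY i × ι => ιB (blkV1 i.hN i.D p.1))
      (conj b ((gradY i (cfg U₁) ∘ₗ (cutMulY (𝔸 := 𝔸) (bumpY i (ctrR i c) (3 * (SC i c : ℝ))) ∘ₗ
        (GpCubeY i c (parSymY i) (gaugeY i (u c)⁻¹ (locCfgY i c η (A c))) ∘ₗ
          ((QpsY i (parSymY i) (cfg U₁) ∘ₗ XinvY i (parSymY i) (fun W => GpY i (parSymY i) W) (cfg U₁) ∘ₗ QpY i (parSymY i) (cfg U₁))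
            - (QpsCubeY i c (parSymY i) (gaugeY i (u c)⁻¹ (locCfgY i c η (A c))) ∘ₗ
                XinvCubeY i c (parSymY i) (gaugeY i (u c)⁻¹ (locCfgY i c η (A c))) ∘ₗ
                QpCubeY i c (parSymY i) (gaugeY i (u c)⁻¹ (locCfgY i c η (A c))))) ∘ₗ
          GpCubeY i c (parSymY i) (gaugeY i (u c)⁻¹ (locCfgY i c η (A c)))) ∘ₗ
        cutMulY (𝔸 := 𝔸) (bumpY i (ctrR i c) (3 * (SC i c : ℝ)))) ∘ₗ divY i (cfg U₁)).restrictScalars ℝ))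
      (fun a y => ε₃ * ((geo9K i).len a ^ 2)⁻¹ * Real.exp (-(ρ * (geo9K i).dist a y))))
    (dB' : ℕ) {αst ρ' Λ' : ℝ} (hΛ' : 0 ≤ Λ') (hρ' : 0 ≤ ρ') (hsplit : αst + ρ' ≤ ρ / δ)
    (h261' : Ineq261 dB' (toB6 (geo9K i) Rr' Hp) δ (1 - ρ')) (hST : ScaleTransfer (geo9K i) δ αst Λ' (fun a => (geo9K i).len a ^ 2)) :
    HasMajorant (g := toB6 (geo9K i) Rr' Hp) (fun p : FBondY i × ι => ιB (blkV1 i.hN i.D p.1))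
      (∑ c : ↥(cubes i.D.toDomains), conj b ((cutMulY (𝔸 := 𝔸) (hBdY i (zetaY i c)) *
        (DPDsY i (parSymY i) (fun W => GpY i (parSymY i) W) (cfg U₁) - locProjBY i c (parSymY i) (u c) (locCfgY i c η (A c))) *
        (cutMulY (𝔸 := 𝔸) (hBdY i (hTY i c)) * Oc c (cfg U₁) * cutMulY (𝔸 := 𝔸) (hBdY i (hTY i c)))).restrictScalars ℝ))
      (fun a b' => (3 * 5 ^ (d + 1)) *
        ((((M₂ * ∑ j, ‖b j‖) * (M₂ * ∑ j, ‖b j‖) * B₁ * Λ ^ 4 * B6.c1 dB δ₀ β' ^ 2 *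
              (((d : ℝ) + 1) * εT * (2 * (M₂ * (∑ j, ‖b j‖) * BG) + εT)) + ε₃) *
            (M₂ * (∑ j, ‖b j‖) * B₀) * Λ' * B6.c1 dB' δ (1 - ρ')) * Real.exp (-(ρ' * δ * (geo9K i).dist a b')))) := by
  obtain ⟨-, -, hdnn⟩ := geo9K_axioms i Rr' Hp
  have hSum : 0 ≤ M₂ * ∑ j, ‖b j‖ := mul_nonneg hM₂ (Finset.sum_nonneg fun j _ => norm_nonneg _)
  have hεD : 0 ≤ (M₂ * (∑ j, ‖b j‖) * BG * (1 + D1 thetaProf / 3)) *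
      (Real.exp (-(asep * δG * (3 / 8 * (i.Mh : ℝ) - 1))) +
        ((M₂ * ∑ j, ‖b j‖) ^ 2 * (θ * B6.c1 dBc δc αc)) * B6.c1 dBE δG (bb - ρE) * Real.exp (-(asep * δG * (3 / 8 * (i.Mh : ℝ) - 2)))) := by
    have h1 : 0 ≤ 1 + D1 thetaProf / 3 := by
      have := B4PartitionUnity22.D1_nonneg B4PartitionUnity22.contDiff_thetaProf B4PartitionUnity22.hasCompactSupport_thetaProf
      positivity
    have h2 : 0 ≤ B6.c1 dBc δc αc := c1_nonneg _ _ _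
    have h3 : 0 ≤ B6.c1 dBE δG (bb - ρE) := c1_nonneg _ _ _
    positivity
  have hεT : 0 ≤ εT := hεD.trans hεDT
  -- both located entries folded to the common kernel `ε_T·ℓ(a)·e^{−δ_T d}`
  have hfold : ∀ {ε δ' : ℝ}, ε ≤ εT → δT ≤ δ' → ∀ a a' : (geo9K i).Site,
      ε * (geo9K i).len a * Real.exp (-(δ' * (geo9K i).dist a a')) ≤ εT * (geo9K i).len a * Real.exp (-(δT * (geo9K i).dist a a')) :=
    fun hε hδ' a a' => mul_le_mul (mul_le_mul_of_nonneg_right hε (B9GeoLemma21KLevelV1.geo9K_len_pos i a).le)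
      (Real.exp_le_exp.2 (neg_le_neg (mul_le_mul_of_nonneg_right hδ' (hdnn a a')))) (Real.exp_nonneg _)
      (mul_nonneg hεT (B9GeoLemma21KLevelV1.geo9K_len_pos i a).le)
  have hDL : ∀ (c : ↥(cubes i.D.toDomains)) (μ : Fin (d + 1)), HasMajorant (g := toB6 (geo9K i) Rr' Hp) (fun p : SiteY i × ι => ιB (blkOf i.D.toDomains p.1))
      (conj b (diffLetter (shiftY i) (UboxY i (cfg U₁)) (((etaS i : ℝ) : ℂ))⁻¹ (Sum.inl μ)) *
        conj b ((etaS i ^ 2) • (cutMulY (𝔸 := 𝔸) (bumpY i (ctrR i c) (3 * (SC i c : ℝ))) ∘ₗ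
          ((fun W => GpY i (parSymY i) W) (cfg U₁) - GpCubeY i c (parSymY i) (gaugeY i (u c)⁻¹ (locCfgY i c η (A c))))).restrictScalars ℝ))
      (fun a a' => εT * (geo9K i).len a * Real.exp (-(δT * (geo9K i).dist a a'))) := fun c μ =>
    hasMajorant_mono (g := toB6 (geo9K i) Rr' Hp) _
      (hasMajorant_hDL_chiL_of_eBlock i c b cfg hE hBG hδG0 ιB hι hM₂ hrepr hη (u c) (hu c) η (A c) (hQ c) (hgA c) hU (hV c) μ dBc dBE
        hθ hδc hαc1 hasep hρE hsplitE hrate (h261c c) h261E (hR c)) (hfold hεDT hδDT)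
  have hDR' : ∀ (c : ↥(cubes i.D.toDomains)) (ν : Fin (d + 1)), HasMajorant (g := toB6 (geo9K i) Rr' Hp) (fun p : SiteY i × ι => ιB (blkOf i.D.toDomains p.1))
      (conj b ((etaS i ^ 2) • (((fun W => GpY i (parSymY i) W) (cfg U₁) - GpCubeY i c (parSymY i) (gaugeY i (u c)⁻¹ (locCfgY i c η (A c)))) ∘ₗ
          cutMulY (𝔸 := 𝔸) (bumpY i (ctrR i c) (3 * (SC i c : ℝ)))).restrictScalars ℝ) *
        conj b (diffLetter (shiftY i) (UboxY i (cfg U₁)) (((etaS i : ℝ) : ℂ))⁻¹ (Sum.inr ν)))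
      (fun a a' => εT * (geo9K i).len a * Real.exp (-(δT * (geo9K i).dist a a'))) := fun c ν =>
    hasMajorant_mono (g := toB6 (geo9K i) Rr' Hp) _ (hDR c ν) (hfold hεR hδR)
  exact hasMajorant_sum_famThree_at_locLetters i b cfg (fun W => GpY i (parSymY i) W) (parSymY i) par (parSymY_isGaugeLawS i) hE hBG Oc hB₀ hδ hEO ιB hι
    hpar hM₂ hrepr hη hs hB₁ hCinv u (fun c => locCfgY i c η (A c)) (fun c w hw κ => agree_of_datum i c (u c) (cfg U₁) (A c) (Q c) η (hQ c) (hgA c) w hw κ)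
    (fun c => bumpY i (ctrR i c) (3 * (SC i c : ℝ))) (fun c _ _ hf hz => chiL_eq_one_of_zetaY_gradK i c hf hz)
    (fun c _ _ hf hz => chiL_eq_one_of_hTY_gradK i c hf hz) hεT hDL hDR' dB hΛ hρ hα hβ hδ₀ hδG' hδX' hδD' hr h261 hT1 hT4 hε₃ hP3 dB' hΛ' hρ' hsplit
    h261' hST

end Record

end Literature.MathematicalPhysics.QuantumFieldTheory.Balaban1983to89.B9Eq3105FamThreeLocDiffGOfEBlock

end
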